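import Summits.QuantumFields.YangMills.Theorems.DiagonalMirrorRPRWilsonDiagonalModelPairingDefs
import Summits.QuantumFields.YangMills.Theorems.DiagonalMirrorRPRTwoShiftProbesPinnedDefs

/-!
# Crux `WeakCouplingHypercubicLimitRP` (stmt-QuantumFields-27398) / aside `DiagonalMirrorRPR` (stmt-QuantumFields-10604), door B, R1-side
# supply chain of D1′ (`stub_oddTorusSwapPairingLiminf`), item (ii) step 4: the Yang–Mills READING of the lead's pinned `swapShiftPairing` as the
# shifted reflected insertion in the `K_u` pair chain of the symmetric light-cone chart

Helper file (`--supports stmt-QuantumFields-27398 --as helper`) of the hand `hand-10604-wilsonDiagModel-2` g3 (docket director-ym g24, O4 WORD 47 (2) /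
48 (1): item (ii)); it closes nothing by itself.

WHAT.  The lead's `swapShiftPairing r sch Y n k = ∫ Y((P_swap U)~) · Y(τ_{−n e₀ + n e₁} Ũ) dμ_k(U)` (✓ `…TwoShiftProbesPinnedDefs`; Wilson's measure on the
scheme's own odd torus `2L_k+1`, `Ũ` the periodic lift) for a `diagBox T`-local functional `Y` is identified with the chain-level object of
`…ShiftedBlockChain` / `…ShiftedSpectralPairing`:
* §1 `obsRead S Y e` — a functional `Y` of the infinite lattice READ on `e + 1` (bond, in-slab) half-layer pairs of the own odd torus (layers `1, …, e+1`
  of hand-1's symmetric chart `(v, u) = (x₀ − x₁, x₀ + x₁)`, the other layers padded by the identity: `padLayers`, hand-2); `famRead r sch F k e` is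
  `obsRead (side k) (famObs r sch F k) e`; measurability, bound, and `obsR_obsRead` (it IS `Y ∘ torusLift ∘ assemble` once `Y` reads only layers `1 … d ≤ e+1`);
* §2 `dependsOn_diagBox_layers` — a `diagBox T`-local `Y` reads only the layers `1, …, 2T` of an assembled own-torus configuration (the link `(x, i)` lies in
  layer `x₀ − x₁ + [i = 0] ∈ [2, 2T]` for `x ∈ diagBox T`; hand-2's `lcEdge_fst_proj`);
* §3 the DIAGONAL SHIFT in the chart: `layerReadU_torusConfigShift_diag`, `torusConfigShift_diag_layerAssembleU` — translating a torus configuration by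
  `−n e₀ + n e₁` shifts the layer index by `2n` and fixes the slab coordinate `u = x₀ + x₁` (odd side: `2` is invertible), so
  `Y(τ_{−n e₀ + n e₁} (assemble Z)~) = Y((assemble (t ↦ Z (t + 2n)))~)`;
* §4 ★★ **`swapShiftPairing_mul_diagCyclicTraceU_eq_integral_pairs`** (`2T ≤ e + 1 < side_k`, ANY `n`):
  `swapShiftPairing r sch Y n k · Tr K_u^{S_k} = ∫ Θf(P) · f(P(· + 2n)) · ∏_t e^{β even_t} e^{β odd_t} dP`, `f = obsRead (side k) Y e`, over pair strings
  `P : ℤ/S_kℤ → HalfCfg × HalfCfg` — hand-1's `integral_wilsonMeasure_eq_diagCyclicU`, hand-2's `swap_layerAssembleU_glue_eq` / `obsR_reflectPairs`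
  (the mirror `x₀ ↔ x₁` is the reflection `reflectPairs` of the pair string) and §1–§3.  This is the left-hand side that
  `…ShiftedSpectralPairing.hasSum_pow_mul_pow_mul_sq_inner_halfBlockOp` expands spectrally (gap `2n`, block depth `e + 1`).

HONEST FRAMING: bookkeeping (a reading of a Wilson expectation through the transfer-matrix chart); no letter is proved; D1′, ⟨27398⟩ (0∕2), S6i and the
aside ⟨10604⟩ are OPEN; nothing here bears on the summit; the Yang–Mills mass gap is NOT proved here or anywhere in the tree.  One `def` (`obsRead`, the
generic form of hand-2's `famRead`), no instance, no notation, `autoImplicit false`.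

References: K. Osterwalder, E. Seiler, Ann. Phys. 110 (1978) §2–3 (transfer matrix, time-slab localisation, translations); E. Seiler, LNP 159 (1982) Ch. 2.
-/

set_option autoImplicit false

noncomputable section

open scoped BigOperators
open MeasureTheory Function Filter Topology
open Literature.MathematicalPhysics.QuantumLattice Literature.MathematicalPhysics.QuantumFieldTheory
open Literature.Probability.LatticeModels (Site)
open Summit.QuantumFields.YangMills.Cruxes.DiagonalMirrorRPR.ParityBridgeColdTraces
open Summit.QuantumFields.YangMills.Cruxes.DiagonalMirrorRPR.SpectralTransfer (swapShiftPairing diagBox)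

namespace Summit.QuantumFields.YangMills.Cruxes.DiagonalMirrorRPR.SignTwistedDiagonalTrace.WilsonDiagonal

/-! ## §1 A lattice functional read on `e + 1` half-layer pairs of the own odd torus -/

section Read

variable (S : ℕ) [NeZero S] {G : Type} [Group G] [MeasurableSpace G]

/-- **A functional of the infinite lattice read on `e + 1` half-layer pairs** of the torus of odd side `S`: `obsRead S Y e (Y⃗, X⃗) = Y(Ũ)` for the
own-torus configuration `U` assembled from the layer string `padLayers e Y⃗ X⃗` (layers `1, …, e+1` carry the given pairs, every other layer the identity).
Hand-2's `famRead r sch F k e` is `obsRead (side k) (famObs r sch F k) e`. -/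
def obsRead (Y : LGConfig 4 G → ℝ) (e : ℕ) (Yh Xh : Fin (e + 1) → HalfCfg S S G) : ℝ :=
  Y (torusLift S (layerAssembleU (padLayers e Yh Xh)))

variable {S}

omit [NeZero S] [MeasurableSpace G] in
/-- `obsRead` is bounded by any bound of the functional. -/
theorem abs_obsRead_le {Y : LGConfig 4 G → ℝ} {B : ℝ} (hB : ∀ V : LGConfig 4 G, |Y V| ≤ B) (e : ℕ)
    (Yh Xh : Fin (e + 1) → HalfCfg S S G) : |obsRead S Y e Yh Xh| ≤ B :=
  hB _

/-- `obsRead` is jointly measurable in the pairs for a measurable functional. -/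
theorem measurable_obsRead {Y : LGConfig 4 G → ℝ} (hY : Measurable Y) (e : ℕ) : Measurable (uncurry (obsRead S Y e)) :=
  hY.comp ((measurable_torusLift S).comp ((measurable_layerAssembleU' (G := G)).comp (measurable_padLayers (G := G) (S' := S) e)))

omit [NeZero S] [MeasurableSpace G] in
/-- **`obsRead` IS the functional** once `Y ∘ torusLift ∘ assemble` reads only the layers `1, …, d` with `d ≤ e + 1 < S`:
`obsR (obsRead S Y e) P = Y((assemble P)~)` for every pair string `P` of the torus (hand-2's `obsR_famRead`, verbatim for a general functional). -/
theorem obsR_obsRead {Y : LGConfig 4 G → ℝ} (e d : ℕ) (hde : d ≤ e + 1) (he : e + 1 < S)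
    (hdep : ∀ Z Z' : ZMod S → LayerCfg S S G, (∀ t : ℤ, 1 ≤ t → t ≤ d → Z (t : ZMod S) = Z' (t : ZMod S)) →
      Y (torusLift S (layerAssembleU Z)) = Y (torusLift S (layerAssembleU Z')))
    (P : ZMod S → HalfCfg S S G × HalfCfg S S G) :
    obsR (obsRead S Y e) P = Y (torusLift S (layerAssembleU fun t => glue (P t).1 (P t).2)) := by
  unfold obsR obsRead
  refine hdep _ _ fun t ht1 htd => ?_
  obtain ⟨tn, rfl⟩ := Int.eq_ofNat_of_zero_le (by omega : (0 : ℤ) ≤ t)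
  have htn1 : 1 ≤ tn := by exact_mod_cast ht1
  have htnd : tn ≤ d := by exact_mod_cast htd
  have hcast : ((tn : ℤ) : ZMod S) = ((tn : ℕ) : ZMod S) := by push_cast; rfl
  rw [hcast]
  have hval : ((tn : ℕ) : ZMod S).val = tn := by
    rw [ZMod.val_natCast, Nat.mod_eq_of_lt (by omega)]
  have hcond : 1 ≤ ((tn : ℕ) : ZMod S).val ∧ ((tn : ℕ) : ZMod S).val ≤ e + 1 := by
    rw [hval]; exact ⟨htn1, by omega⟩
  simp only [padLayers, hcond, and_self, dif_pos]
  have hidx : (((((tn : ℕ) : ZMod S).val - 1 + 1 : ℕ)) : ZMod S) = ((tn : ℕ) : ZMod S) := by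
    rw [hval, Nat.sub_add_cancel htn1]
  simp only [hidx]

end Read

/-! ## §2 A `diagBox`-local functional reads only the layers `1, …, 2T` -/

section Box

variable {S : ℕ} {G : Type}

/-- **Layer support of a `diagBox T`-local functional.**  If two layer strings agree on the layers `1, …, 2T` (integer labels cast into `ℤ/Sℤ`), a
functional depending only on the links of `diagBox T = {1 ≤ x₀ ≤ T, −T ≤ x₁ ≤ −1}` takes the same value at the periodic lifts of the two assembled
configurations: the link `(x, i)` lies in layer `x₀ − x₁ + [i = 0]`, which is in `[2, 2T]` on the box. -/
theorem dependsOn_diagBox_layers {Y : LGConfig 4 G → ℝ} {T : ℕ} (hY : DependsOn Y (diagBox T)) (Z Z' : ZMod S → LayerCfg S S G)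
    (h : ∀ t : ℤ, 1 ≤ t → t ≤ 2 * T → Z (t : ZMod S) = Z' (t : ZMod S)) :
    Y (torusLift S (layerAssembleU Z)) = Y (torusLift S (layerAssembleU Z')) := by
  refine hY fun e he => ?_
  obtain ⟨y, i⟩ := e
  simp only [diagBox, Set.mem_setOf_eq] at he
  obtain ⟨h1, h2, h3, h4⟩ := he
  show Z (lcEdge (torusEdge S (y, i))).1 (lcEdge (torusEdge S (y, i))).2 = Z' (lcEdge (torusEdge S (y, i))).1 (lcEdge (torusEdge S (y, i))).2
  have hlayer : (lcEdge (torusEdge S (y, i))).1 = (((y 0 - y 1 + if i = 0 then 1 else 0 : ℤ)) : ZMod S) := lcEdge_fst_proj y i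
  rw [hlayer, h _ (by split_ifs <;> omega) (by split_ifs at h2 h4 ⊢ <;> omega)]

end Box

/-! ## §3 The diagonal translation `−n e₀ + n e₁` in the symmetric chart: a shift of the layer index by `2n` -/

section Shift

variable {S : ℕ} {G : Type*}

/-- In the symmetric chart, subtracting the torus vector `(−n, n, 0, 0)` from the site `lcInv (c, s)` adds `2n` to the slab index and fixes the slab
coordinate (odd `S`). -/
theorem lcInv_sub_diag (hS : Odd S) (c : ZMod S) (s : SlabSite S S) (n : ℕ) :
    lcInv (c, s) - Literature.Probability.LatticeModels.Torus.proj S (-Pi.single 0 (n : ℤ) + Pi.single 1 (n : ℤ)) =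
      lcInv (c + 2 * (n : ZMod S), s) := by
  obtain ⟨u, y, z⟩ := s
  have h2 := two_mul_half (S := S) hS
  funext j
  fin_cases j <;>
    simp [lcInv, Literature.Probability.LatticeModels.Torus.proj_apply]
  · linear_combination (-(n : ZMod S)) * h2
  · linear_combination (n : ZMod S) * h2

variable [MeasurableSpace G]

/-- **The diagonal translation shifts the layers**: layer `t` of `τ_{(−n, n, 0, 0)} U` is layer `t + 2n` of `U` (odd `S`). -/
theorem layerReadU_torusConfigShift_diag (hS : Odd S) (U : GaugeConfig 4 S G) (n : ℕ) (t : ZMod S) :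
    layerReadU (torusConfigShift (Literature.Probability.LatticeModels.Torus.proj S (-Pi.single 0 (n : ℤ) + Pi.single 1 (n : ℤ))) U) t =
      layerReadU U (t + 2 * (n : ZMod S)) := by
  funext p
  simp only [layerReadU, torusConfigShift_apply]
  rw [lcInv_sub_diag hS]
  by_cases hp : p.2 = 0
  · rw [if_pos hp, if_pos hp, sub_add_eq_add_sub]
  · rw [if_neg hp, if_neg hp]

/-- The translated assembled configuration is assembled from the shifted layer string: `τ_{(−n, n, 0, 0)} (assemble Z) = assemble (t ↦ Z (t + 2n))`. -/
theorem torusConfigShift_diag_layerAssembleU (hS : Odd S) (Z : ZMod S → LayerCfg S S G) (n : ℕ) :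
    torusConfigShift (Literature.Probability.LatticeModels.Torus.proj S (-Pi.single 0 (n : ℤ) + Pi.single 1 (n : ℤ))) (layerAssembleU Z) =
      layerAssembleU fun t => Z (t + 2 * (n : ZMod S)) := by
  rw [← layerAssembleU_layerReadU hS (torusConfigShift _ (layerAssembleU Z))]
  congr 1
  funext t
  rw [layerReadU_torusConfigShift_diag hS, layerReadU_layerAssembleU hS]

/-- **On the infinite lattice**: `Y(τ_{−n e₀ + n e₁} (assemble Z)~) = Y((assemble (t ↦ Z (t + 2n)))~)` — the periodic lift intertwines the two
translations (tree `toTorusObservable_comp_configShift`). -/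
theorem apply_configShift_diag_torusLift_layerAssembleU {α : Type*} (hS : Odd S) (Y : LGConfig 4 G → α) (Z : ZMod S → LayerCfg S S G) (n : ℕ) :
    Y (configShift (-Pi.single 0 (n : ℤ) + Pi.single 1 (n : ℤ)) (torusLift S (layerAssembleU Z))) =
      Y (torusLift S (layerAssembleU fun t => Z (t + 2 * (n : ZMod S)))) := by
  have h := congrFun (toTorusObservable_comp_configShift (G := G) S (-Pi.single 0 (n : ℤ) + Pi.single 1 (n : ℤ)) Y) (layerAssembleU Z)
  simp only [toTorusObservable, Function.comp_apply] at h
  rw [h, torusConfigShift_diag_layerAssembleU hS]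

end Shift

/-! ## §4 ★★ The pinned swap-shift pairing as the shifted reflected insertion in the pair chain -/

section Pairing

variable {G : Type} [Group G] [TopologicalSpace G] [IsTopologicalGroup G] [CompactSpace G]
  [MeasurableSpace G] [BorelSpace G] (r : LatticeRep G) (sch : SpeciesScheme (YMSpecies G))

/-- The lead's `swapShiftPairing` with the torus side written as `sch.side k` (definitionally `2 L_k + 1`). -/
theorem swapShiftPairing_eq_integral_side (Y : LGConfig 4 G → ℝ) (n k : ℕ) :
    swapShiftPairing r sch Y n k =
      ∫ U, Y (torusLift (sch.side k) (configPerm (Equiv.swap (0 : Fin 4) 1) U)) *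
          Y (configShift (-Pi.single 0 (n : ℤ) + Pi.single 1 (n : ℤ)) (torusLift (sch.side k) U))
        ∂(wilsonMeasure (d := 4) (L := sch.side k) r.ρ (sch.β k)) :=
  rfl

/-- ★★ **`swapShiftPairing · Tr K_u^{S_k}` as the shifted reflected insertion.**  For a `diagBox T`-local functional `Y` and a reading depth with
`2T ≤ e + 1 < S_k`: `swapShiftPairing r sch Y n k · diagCyclicTraceU ρ β_k S_k = ∫ Θf(P) · f(P(· + 2n)) · ∏_t e^{β even_t} e^{β odd_t} dP` with `f = obsRead S_k Y e`,
over strings `P : ℤ/S_kℤ → HalfCfg × HalfCfg` of (bond, in-slab) half-layer pairs with the product half-layer Haar measure: the mirror `x₀ ↔ x₁` reflects the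
pair string (`reflectPairs`), the translation `−n e₀ + n e₁` shifts it by `2n` layers. -/
theorem swapShiftPairing_mul_diagCyclicTraceU_eq_integral_pairs (Y : LGConfig 4 G → ℝ) {T : ℕ} (hY : DependsOn Y (diagBox T)) (k e n : ℕ)
    (h2T : 2 * T ≤ e + 1) (he : e + 1 < sch.side k) :
    swapShiftPairing r sch Y n k * diagCyclicTraceU r.ρ (sch.β k) (sch.side k) (S := sch.side k) (G := G) =
      ∫ P : ZMod (sch.side k) → HalfCfg (sch.side k) (sch.side k) G × HalfCfg (sch.side k) (sch.side k) G,
          obsL (obsRead (sch.side k) Y e) P * obsR (obsRead (sch.side k) Y e) (fun t => P (t + (((2 * n : ℕ)) : ZMod (sch.side k)))) *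
            ∏ t : ZMod (sch.side k), Real.exp (sch.β k * evenActionU r.ρ (P t).1 (P t).2 (P (t + 1)).1) *
              Real.exp (sch.β k * oddActionU r.ρ (P t).2 (P (t + 1)).1 (P (t + 1)).2)
        ∂(Measure.pi fun _ : ZMod (sch.side k) => (halfHaar (sch.side k) G).prod (halfHaar (sch.side k) G)) := by
  haveI : SecondCountableTopology G := (r.continuous.isClosedEmbedding r.injective).isEmbedding.secondCountableTopology
  have hS : Odd (sch.side k) := ⟨sch.L k, rfl⟩
  rw [swapShiftPairing_eq_integral_side, integral_wilsonMeasure_eq_diagCyclicU r.ρ (sch.β k) hS r.continuous,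
    div_mul_cancel₀ _ (diagCyclicTraceU_side_pos r.ρ (sch.β k) hS r.continuous).ne']
  set S := sch.side k with hSdef
  haveI : SigmaFinite (layerHaar S S G) := by unfold layerHaar; infer_instance
  haveI : SigmaFinite ((halfHaar S G).prod (halfHaar S G)) := by unfold halfHaar; infer_instance
  -- the readings of `Y` on pair strings
  have hdep : ∀ Z Z' : ZMod S → LayerCfg S S G, (∀ t : ℤ, 1 ≤ t → t ≤ 2 * T → Z (t : ZMod S) = Z' (t : ZMod S)) →
      Y (torusLift S (layerAssembleU Z)) = Y (torusLift S (layerAssembleU Z')) := dependsOn_diagBox_layers hY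
  have hR : ∀ Q : ZMod S → HalfCfg S S G × HalfCfg S S G,
      obsR (obsRead S Y e) Q = Y (torusLift S (layerAssembleU fun t => glue (Q t).1 (Q t).2)) :=
    fun Q => obsR_obsRead e (2 * T) h2T he hdep Q
  -- layer strings as pair strings
  have hmp : MeasurePreserving (fun (P : ZMod S → HalfCfg S S G × HalfCfg S S G) (t : ZMod S) => glueEquiv (P t))
      (Measure.pi fun _ : ZMod S => (halfHaar S G).prod (halfHaar S G)) (Measure.pi fun _ : ZMod S => layerHaar S S G) :=
    measurePreserving_pi _ _ fun _ => measurePreserving_glueEquiv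
  rw [← hmp.integral_comp (MeasurableEquiv.piCongrRight fun _ : ZMod S =>
    (glueEquiv : HalfCfg S S G × HalfCfg S S G ≃ᵐ LayerCfg S S G)).measurableEmbedding]
  refine integral_congr_ae (ae_of_all _ fun P => ?_)
  dsimp only
  have hglue : (fun t : ZMod S => glueEquiv (P t)) = fun t => glue (P t).1 (P t).2 := by
    funext t; exact glueEquiv_apply (P t).1 (P t).2
  have h2n : (((2 * n : ℕ)) : ZMod S) = 2 * (n : ZMod S) := by push_cast; ring
  rw [hglue, swap_layerAssembleU_glue_eq hS P, apply_configShift_diag_torusLift_layerAssembleU hS Y _ n, ← hR (reflectPairs P), obsR_reflectPairs,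
    h2n, ← hR (fun t => P (t + 2 * (n : ZMod S)))]
  congr 1
  refine Finset.prod_congr rfl fun t _ => ?_
  rw [show glueEquiv (P t) = glue (P t).1 (P t).2 from glueEquiv_apply (P t).1 (P t).2,
    show glueEquiv (P (t + 1)) = glue (P (t + 1)).1 (P (t + 1)).2 from glueEquiv_apply (P (t + 1)).1 (P (t + 1)).2, stepKernelU_glue]

end Pairing

end Summit.QuantumFields.YangMills.Cruxes.DiagonalMirrorRPR.SignTwistedDiagonalTrace.WilsonDiagonal

end
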